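import Summits.NavierStokesRegularity.NavierStokesRegularity.Theorems.ScenarioCensusModeRankSpatial
import HarnessLib

/-!
# LINE «mode-rank» port, part 3/4: the decaying shell `curl_eq_zero_of_negShell`, the gauge step, `Row_A1sh` and `row_A1sh_holds` (A1sh DECIDED)

Re-homed for the scenario census (typer seat ns-census-typer-1 g8; the cells A1sh / A1sep are MEMBERS OF RECORD «DECIDED IN KERNEL IN FILES» of row
A1apT since census v1.71 (critic idea-crit-3 g6 PASS — no price 20:24:04Z; ref ns-census-ref g8 PRE-CHECK ✓ §13.14 item 9; lead-presearch label); this port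
makes them TREE-decided): VERBATIM PORT of ns-idea-2 LINE g12-1 «mode-rank», `pub/ideators/ns-idea-2/lines/mode-rank/line-mode-rank.lean` sha16
fb66c8a2d8442bee (1040 l., lean check rc 0, 0 sorry), split for the 400-line rule into `ScenarioCensusModeRank` (§A1–§A3) → `…ModeRankSpatial` (§A4, §B
instrument) → `…ModeRankShell` (§B decaying shell, `Row_A1sh`) → `…ModeRankRows` (§B separable row, head cell, census KEYS).  Lean text VERBATIM in namespace
`…Theorems.ScenarioCensus.ModeRank` (the line's `…Lines.ModeRank` re-homed); port edits: the two `local notation "E3"` lines (inside `section Spatial` /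
`section Rows`) → one `abbrev E3` at namespace level and the bracket lines `section Rows` / `end Rows` dropped (no `variable`s in that section; typer lint: no
notation in port files), `@[conjecture]` on the OPEN head cell `Row_A1rk` (typed only, no witness); the helper `abs_apply_le_norm` (`|z i| ≤ ‖z‖`, a verbatim twin of a landed
Literature lemma — gate lint `dedup.landed`) is not re-declared and its single use in `curl_eq_zero_of_negShell` is Mathlib's `PiLp.norm_apply_le`; likewise
`tendsto_typeI_bound` (`C/√(-s) → 0`, twin of a landed tree lemma in a module the farm does not build) is not re-declared and its single use in
`tendsto_slice_atBot` carries the one-line Mathlib proof inline (proof text only).  Statements untouched.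

No census VALUE is moved here (row A1apT keeps its value; the members become TREE-decided by name); NS regularity is NOT proved; (L′)
`TypeIAncientLiouville` ⟨10661⟩ is untouched; no summit statement is proved by this file.
-/

-- the summit and its single problem share the name `NavierStokesRegularity` (D-0017 nested layout)
set_option linter.dupNamespace false

noncomputable section

open Set Function Filter Topology

namespace Summit.NavierStokesRegularity.NavierStokesRegularity.Theorems.ScenarioCensus.ModeRank

open Literature.Analysis Literature.Analysis.FluidPDE InnerProductSpace
open Summit.NavierStokesRegularity.NavierStokesRegularity.Theorems (vorticity_eq_deriv_of_typeI)
open scoped Laplacian InnerProductSpace RealInnerProductSpace ContDiff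

/-- **The dynamic step (decaying shell `μ < 0`).**  For a Type-I ancient mild field with
single-shell Galerkin slices on a shell `μ < 0`, the vorticity vanishes identically: the projected
vorticity equation is a damped linear ODE with Type-I-small forcing (`eq_zero_of_damped`). -/
theorem curl_eq_zero_of_negShell {C : ℝ} {u : ℝ → E3 → E3} (hu : IsTypeIAncientMild C u)
    {n : ℕ} {φ : Fin n → E3 → E3} {μ : ℝ} (hμ : μ < 0) (hφ : ∀ i, ContDiff ℝ 3 (φ i))
    (hΔ : ∀ i x, (Δ (curl (φ i))) x = μ • curl (φ i) x)
    (hcl : ∀ a : Fin n → ℝ, ∃ b : Fin n → ℝ, ∀ x,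
      vortNL (fun y => ∑ i, a i • φ i y) x = ∑ i, b i • curl (φ i) x)
    (hsl : ∀ t < 0, ∃ a : Fin n → ℝ, ∀ x, u t x = ∑ i, a i • φ i x) :
    ∀ t < 0, ∀ x, curl (u t) x = 0 := by
  have hV := span_modes hφ
  have hmemV := slice_mem_span hsl
  -- smoothness bookkeeping
  have hsm : IsSmoothSpaceTimeOn (Iio 0) u := hu.contDiffOn
  have hvsm : IsSmoothSpaceTimeOn (Iio 0) (vorticity u) :=
    hsm.isSmoothSpaceTimeOn_vorticity isOpen_Iio.uniqueDiffOn
  have hcφ : ∀ i, ContDiff ℝ 2 (curl (φ i)) := fun i => contDiff_curl (hφ i)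
  -- ### the velocity space `V` and the vorticity space `W`
  set V : Submodule ℝ (E3 → E3) := Submodule.span ℝ (Set.range φ) with hVdef
  set W : Submodule ℝ (E3 → E3) := Submodule.span ℝ (Set.range fun i => curl (φ i)) with hWdef
  haveI : FiniteDimensional ℝ V := FiniteDimensional.span_of_finite ℝ (Set.finite_range φ)
  haveI : FiniteDimensional ℝ W :=
    FiniteDimensional.span_of_finite ℝ (Set.finite_range fun i => curl (φ i))
  -- every element of `W` is `C²` with `Δ w = μ w`
  have hW : ∀ w ∈ W, ContDiff ℝ 2 w ∧ ∀ x, (Δ w) x = μ • w x := by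
    intro w hw
    induction hw using Submodule.span_induction with
    | mem w hw =>
      obtain ⟨i, rfl⟩ := hw
      exact ⟨hcφ i, hΔ i⟩
    | zero =>
      exact ⟨contDiff_const, fun x => by rw [laplacian_zero_fun]; simp⟩
    | add v w _ _ hv hw =>
      refine ⟨hv.1.add hw.1, fun x => ?_⟩
      rw [(hv.1.contDiffAt).laplacian_add (hw.1.contDiffAt), hv.2 x, hw.2 x]
      simp [smul_add]
    | smul a v _ hv =>
      refine ⟨hv.1.const_smul a, fun x => ?_⟩
      rw [InnerProductSpace.laplacian_smul a hv.1.contDiffAt, hv.2 x]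
      simp [smul_smul, mul_comm]

  -- ### the nonlinearity closes into `W`
  have hNL : ∀ v ∈ V, vortNL v ∈ W := by
    intro v hv
    obtain ⟨a, ha⟩ := (Submodule.mem_span_range_iff_exists_fun ℝ).1 hv
    obtain ⟨b, hb⟩ := hcl a
    have h1 : v = fun y => ∑ i, a i • φ i y := by
      rw [← ha]; funext y; simp [Finset.sum_apply, Pi.smul_apply]
    have h2 : vortNL v = ∑ k, b k • curl (φ k) := by
      funext x; rw [h1, hb x]; simp [Finset.sum_apply, Pi.smul_apply]
    rw [h2]
    exact Submodule.sum_mem _ fun k _ => Submodule.smul_mem _ _ (Submodule.subset_span ⟨k, rfl⟩)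
  -- ### the curl as a linear map `V → W`, the curves `U`, `Ω`, `NW`
  let curlV : V →ₗ[ℝ] W :=
    { toFun := fun v => ⟨curl (v : E3 → E3), (hV v v.2).2⟩
      map_add' := fun v w => by
        apply Subtype.ext
        simp only [Submodule.coe_add]
        funext x
        exact curl_add ((hV v v.2).1.differentiable (by norm_num) x)
          ((hV w w.2).1.differentiable (by norm_num) x)
      map_smul' := fun a v => by
        apply Subtype.ext
        simp only [Submodule.coe_smul, RingHom.id_apply]
        funext x
        exact curl_const_smul ((hV v v.2).1.differentiable (by norm_num) x) a }
  let U : ℝ → V := fun s => if h : s < 0 then ⟨u s, hmemV s h⟩ else 0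
  have hU : ∀ s < 0, (U s : E3 → E3) = u s := fun s hs => by simp [U, dif_pos hs]
  let Ω : ℝ → W := fun s => curlV (U s)
  have hΩ : ∀ s < 0, (Ω s : E3 → E3) = curl (u s) := fun s hs => by
    show curl (U s : E3 → E3) = curl (u s)
    rw [hU s hs]
  let NW : ℝ → W := fun s => if h : s < 0 then ⟨vortNL (u s), hNL _ (hmemV s h)⟩ else 0
  have hNW : ∀ s < 0, (NW s : E3 → E3) = vortNL (u s) := fun s hs => by simp [NW, dif_pos hs]
  -- ### Euclidean coordinates on `W`
  let bW := Module.finBasis ℝ W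
  let ℓ : W →ₗ[ℝ] EuclideanSpace ℝ (Fin (Module.finrank ℝ W)) :=
    (bW.equivFun.trans (WithLp.linearEquiv 2 ℝ (Fin (Module.finrank ℝ W) → ℝ)).symm).toLinearMap
  have hℓinj : Function.Injective ℓ := LinearEquiv.injective _
  have hℓapply : ∀ w j, ℓ w j = bW.equivFun w j := fun w j => rfl
  let c : ℝ → EuclideanSpace ℝ (Fin (Module.finrank ℝ W)) := fun s => ℓ (Ω s)
  let g : ℝ → EuclideanSpace ℝ (Fin (Module.finrank ℝ W)) := fun s => ℓ (NW s)
  -- ### the projected vorticity equation `c' = μ c - g`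
  have hderiv : ∀ t < 0, HasDerivAt c (μ • c t - g t) t := by
    intro t ht
    have hpt : ∀ x, HasDerivAt (fun s => (Ω s : E3 → E3) x)
        (((μ • Ω t - NW t : W) : E3 → E3) x) t := by
      intro x
      have h1 : HasDerivAt (fun s => vorticity u s x) (deriv (fun s => vorticity u s x) t) t :=
        hvsm.hasDerivAt_timeLine isOpen_Iio ht x
      simp only [vorticity_apply] at h1
      have h2 := vorticity_eq_deriv_of_typeI hu ht x
      have hΔt : (Δ (curl (u t))) x = μ • curl (u t) x := (hW _ (hV _ (hmemV t ht)).2).2 x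
      rw [hΔt] at h2
      have h3 : deriv (fun s => curl (u s) x) t = μ • curl (u t) x - vortNL (u t) x := by
        have h4 := eq_sub_of_add_eq h2
        rw [h4]
        simp only [vortNL, vortB]
        abel
      rw [h3] at h1
      have hev : (fun s => (Ω s : E3 → E3) x) =ᶠ[𝓝 t] fun s => curl (u s) x := by
        filter_upwards [Iio_mem_nhds ht] with s hs
        rw [hΩ s hs]
      have hval : ((μ • Ω t - NW t : W) : E3 → E3) x = μ • curl (u t) x - vortNL (u t) x := by
        rw [Submodule.coe_sub, Submodule.coe_smul, Pi.sub_apply, Pi.smul_apply, hΩ t ht, hNW t ht]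
      rw [hval]
      exact h1.congr_of_eventuallyEq hev
    have h := hasDerivAt_linearMap_of_pointwise ℓ hpt
    simpa [c, g, map_sub, map_smul] using h
  -- ### the far past: `U → 0` pointwise, hence `c → 0`
  have hUlim : ∀ x, Tendsto (fun s => (U s : E3 → E3) x) atBot (𝓝 (((0 : V) : E3 → E3) x)) := by
    intro x
    have hev : (fun s => u s x) =ᶠ[atBot] fun s => (U s : E3 → E3) x := by
      filter_upwards [Iio_mem_atBot 0] with s hs
      rw [hU s hs]
    rw [Submodule.coe_zero, Pi.zero_apply]
    exact (tendsto_slice_atBot hu x).congr' hev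
  have hc0 : Tendsto (fun t => ‖c t‖) atBot (𝓝 0) := by
    have h := tendsto_linearMap_of_pointwise (ℓ ∘ₗ curlV) hUlim
    rw [map_zero] at h
    exact tendsto_zero_iff_norm_tendsto_zero.1 h
  -- ### velocity coordinates and the auxiliary space `F ⊇ W`
  let bV := Module.finBasis ℝ V
  let aV : ℝ → Fin (Module.finrank ℝ V) → ℝ := fun s => bV.equivFun (U s)
  let ψ : Fin (Module.finrank ℝ V) → E3 → E3 := fun l => (bV l : E3 → E3)
  let χ : Fin (Module.finrank ℝ W) → E3 → E3 := fun j => (bW j : E3 → E3)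
  let SB : Submodule ℝ (E3 → E3) := Submodule.span ℝ
    (Set.range fun p : Fin (Module.finrank ℝ V) × Fin (Module.finrank ℝ W) => vortB (ψ p.1) (χ p.2))
  haveI : FiniteDimensional ℝ SB := FiniteDimensional.span_of_finite ℝ (Set.finite_range _)
  let F : Submodule ℝ (E3 → E3) := W ⊔ SB
  haveI : FiniteDimensional ℝ F := Submodule.finiteDimensional_sup W SB
  let bF := Module.finBasis ℝ F
  let P : F →ₗ[ℝ] EuclideanSpace ℝ (Fin (Module.finrank ℝ F)) :=
    (bF.equivFun.trans (WithLp.linearEquiv 2 ℝ (Fin (Module.finrank ℝ F) → ℝ)).symm).toLinearMap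
  have hPinj : Function.Injective P := LinearEquiv.injective _
  let incl : W →ₗ[ℝ] F := Submodule.inclusion le_sup_left
  have hincl : Function.Injective incl := Submodule.inclusion_injective _
  obtain ⟨K₁, hK₁0, hK₁⟩ :=
    exists_norm_le_mul_norm_of_injective (P ∘ₗ incl) (hPinj.comp hincl) ℓ
  have hBmem : ∀ l j, vortB (ψ l) (χ j) ∈ F := fun l j =>
    Submodule.mem_sup_right (Submodule.subset_span ⟨(l, j), rfl⟩)
  let Bm : Fin (Module.finrank ℝ V) → Fin (Module.finrank ℝ W) → F :=
    fun l j => ⟨vortB (ψ l) (χ j), hBmem l j⟩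
  set M₀ : ℝ := ∑ l, ∑ j, ‖P (Bm l j)‖ with hM₀
  -- ### expansions of `u t`, `curl (u t)` and `N(u t)` in the bases
  have hexpU : ∀ t < 0, u t = fun y => ∑ l, aV t l • ψ l y := by
    intro t ht
    have h := congrArg (fun v : V => (v : E3 → E3)) (bV.sum_equivFun (U t))
    simp only [Submodule.coe_sum, Submodule.coe_smul] at h
    rw [← hU t ht, ← h]
    funext y
    simp [Finset.sum_apply, Pi.smul_apply, aV, ψ]
  have hexpΩ : ∀ t < 0, curl (u t) = fun y => ∑ j, c t j • χ j y := by
    intro t ht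
    have h := congrArg (fun v : W => (v : E3 → E3)) (bW.sum_equivFun (Ω t))
    simp only [Submodule.coe_sum, Submodule.coe_smul] at h
    rw [← hΩ t ht, ← h]
    funext y
    simp [Finset.sum_apply, Pi.smul_apply, χ, hℓapply, c]
  have hNexp : ∀ t < 0, ∀ x,
      vortNL (u t) x = ∑ l, ∑ j, (aV t l * c t j) • vortB (ψ l) (χ j) x := by
    intro t ht x
    have hdψ : ∀ l, DifferentiableAt ℝ (ψ l) x := fun l =>
      (hV _ (bV l).2).1.differentiable (by norm_num) x
    have hdχ : ∀ j, DifferentiableAt ℝ (χ j) x := fun j =>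
      (hW _ (bW j).2).1.differentiable (by norm_num) x
    rw [vortNL, hexpΩ t ht, hexpU t ht]
    exact vortB_sum_sum ψ χ (aV t) (c t) hdψ hdχ
  have hNF : ∀ t < 0, incl (NW t) = ∑ l, ∑ j, (aV t l * c t j) • Bm l j := by
    intro t ht
    apply Subtype.ext
    simp only [Submodule.coe_sum, Submodule.coe_smul, incl, Submodule.coe_inclusion, Bm]
    rw [hNW t ht]
    funext x
    simp only [Finset.sum_apply, Pi.smul_apply]
    exact hNexp t ht x
  -- ### the Type-I smallness of the forcing: `‖g t‖ ≤ ε t ‖c t‖`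
  set ε : ℝ → ℝ := fun t => K₁ * M₀ * ∑ l, |aV t l| with hεdef
  have hgbound : ∀ t < 0, ‖g t‖ ≤ ε t * ‖c t‖ := by
    intro t ht
    have h1 : ‖g t‖ ≤ K₁ * ‖P (incl (NW t))‖ := hK₁ (NW t)
    have h2 : ‖P (incl (NW t))‖ ≤ M₀ * (∑ l, |aV t l|) * ‖c t‖ := by
      rw [hNF t ht, map_sum]
      calc ‖∑ l, P (∑ j, (aV t l * c t j) • Bm l j)‖
          ≤ ∑ l, ‖P (∑ j, (aV t l * c t j) • Bm l j)‖ := norm_sum_le _ _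
        _ ≤ ∑ l, ∑ j, |aV t l| * |c t j| * ‖P (Bm l j)‖ := by
            gcongr with l _
            rw [map_sum]
            refine (norm_sum_le _ _).trans ?_
            gcongr with j _
            rw [map_smul, norm_smul, Real.norm_eq_abs, abs_mul]
        _ ≤ ∑ l, ∑ j, (∑ l', |aV t l'|) * ‖c t‖ * ‖P (Bm l j)‖ := by
            gcongr with l _ j _
            · exact Finset.single_le_sum (fun i _ => abs_nonneg (aV t i)) (Finset.mem_univ l)
            · simpa only [Real.norm_eq_abs] using PiLp.norm_apply_le (c t) j
        _ = M₀ * (∑ l, |aV t l|) * ‖c t‖ := by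
            simp_rw [← Finset.mul_sum]
            rw [hM₀]; ring
    calc ‖g t‖ ≤ K₁ * (M₀ * (∑ l, |aV t l|) * ‖c t‖) := h1.trans (mul_le_mul_of_nonneg_left h2 hK₁0)
      _ = ε t * ‖c t‖ := by rw [hεdef]; ring
  -- ### continuity of `ε` on `t < 0` and `ε → 0` in the far past
  have haVcont : ∀ t < 0, ∀ l, ContinuousAt (fun s => aV s l) t := by
    intro t ht l
    have hpt : ∀ x, ContinuousAt (fun s => (U s : E3 → E3) x) t := by
      intro x
      have h1 : ContinuousAt (fun s => u s x) t :=
        (hsm.hasDerivAt_timeLine isOpen_Iio ht x).continuousAt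
      refine h1.congr_of_eventuallyEq ?_
      filter_upwards [Iio_mem_nhds ht] with s hs
      rw [hU s hs]
    have h := continuousAt_linearMap_of_pointwise (bV.coord l) hpt
    simpa [aV, Module.Basis.equivFun_apply, Module.Basis.coord_apply] using h
  have hεc : ContinuousOn ε (Iio 0) := by
    intro t ht
    have h : ContinuousAt (fun s => ∑ l, |aV s l|) t := by
      have := tendsto_finsetSum (Finset.univ) fun l (_ : l ∈ Finset.univ) =>
        ((continuous_abs.tendsto _).comp (haVcont t ht l))
      exact this
    exact (continuousAt_const.mul h).continuousWithinAt
  have hε : Tendsto ε atBot (𝓝 0) := by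
    have h1 : ∀ l, Tendsto (fun s => aV s l) atBot (𝓝 0) := by
      intro l
      have h := tendsto_linearMap_of_pointwise (bV.coord l) hUlim
      rw [map_zero] at h
      simpa [aV, Module.Basis.equivFun_apply, Module.Basis.coord_apply] using h
    have h2 : Tendsto (fun s => ∑ l, |aV s l|) atBot (𝓝 0) := by
      have := tendsto_finsetSum (Finset.univ) fun l (_ : l ∈ Finset.univ) =>
        ((continuous_abs.tendsto _).comp (h1 l))
      simpa using this
    have h3 := h2.const_mul (K₁ * M₀)
    simpa [hεdef] using h3
  -- ### the damping lemma: `c ≡ 0`, hence `curl (u t) ≡ 0`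
  have hczero : ∀ t < 0, c t = 0 := eq_zero_of_damped hμ hderiv hgbound hεc hε hc0
  intro t ht x
  have h1 : Ω t = 0 := hℓinj (by rw [map_zero]; exact hczero t ht)
  have h2 : curl (u t) = 0 := by
    rw [← hΩ t ht, h1, Submodule.coe_zero]
  rw [h2]; rfl

/-- **The gauge step.** A Type-I ancient mild field whose every slice has spatially constant curl
vanishes: bounded divergence-free slices with constant curl are constant
(`apply_eq_apply_of_curl_const`), and the KNSS gauge kills slice-constant elements
(`IsTypeIAncientMild.eq_zero_of_slice_const`). -/
theorem eq_zero_of_curl_slice_const {C : ℝ} {u : ℝ → E3 → E3} (hu : IsTypeIAncientMild C u)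
    (h : ∀ t < 0, ∃ b : E3, ∀ x, curl (u t) x = b) : ∀ t < 0, ∀ x, u t x = 0 := by
  have hconst : ∀ t < 0, ∀ x, u t x = u t 0 := by
    intro t ht x
    obtain ⟨b, hb⟩ := h t ht
    exact apply_eq_apply_of_curl_const ((hu.contDiff_slice ht).of_le (by norm_cast)) hb
      (hu.isDivFree ht) (fun y => hu.norm_le ht y) x 0
  intro t ht x
  exact hu.eq_zero_of_slice_const (b := fun s => u s 0) hconst ht x

/-- **Row A1sh (single-shell Galerkin slices)** — census A-block cell, (L′)-shape over the genuine
class `IsTypeIAncientMild C u` BY NAME: if every slice `u(t)`, `t < 0`, lies in the span of finitely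
many `C³` modes `φᵢ : ℝ³ → ℝ³` with bounded curls, whose curls lie in ONE eigenspace of the vector
Laplacian (`Δ (curl φᵢ) = μ • curl φᵢ` for a single `μ ∈ ℝ` — decaying shell `μ < 0`, the harmonic
shell `μ = 0`, or `μ > 0`), and on whose span the vorticity nonlinearity closes
(`N(∑ aᵢ φᵢ) ∈ span {curl φₖ}`), then `u ≡ 0` on `t < 0`. -/
def Row_A1sh : Prop :=
  ∀ (C : ℝ) (u : ℝ → E3 → E3), IsTypeIAncientMild C u →
  ∀ (n : ℕ) (φ : Fin n → E3 → E3) (μ : ℝ),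
    (∀ i, ContDiff ℝ 3 (φ i)) →
    (∀ i, ∃ A : ℝ, ∀ x, ‖curl (φ i) x‖ ≤ A) →
    (∀ i x, (Δ (curl (φ i))) x = μ • curl (φ i) x) →
    (∀ a : Fin n → ℝ, ∃ b : Fin n → ℝ, ∀ x,
        vortNL (fun y => ∑ i, a i • φ i y) x = ∑ i, b i • curl (φ i) x) →
    (∀ t < 0, ∃ a : Fin n → ℝ, ∀ x, u t x = ∑ i, a i • φ i x) →
    ∀ t < 0, ∀ x, u t x = 0

/-- **Row A1sh holds** (sorry-free): decaying shells by the dynamic step, the harmonic shell by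
Liouville (bounded harmonic vorticity modes are constant), positive shells are empty
(`eq_zero_of_laplacian_eq_smul_of_pos`); then the gauge step. -/
theorem row_A1sh_holds : Row_A1sh := by
  intro C u hu n φ μ hφ hbd hΔ hcl hsl
  have hV := span_modes hφ
  have hmemV := slice_mem_span hsl
  have hcφ : ∀ i, ContDiff ℝ 2 (curl (φ i)) := fun i => contDiff_curl (hφ i)
  refine eq_zero_of_curl_slice_const hu fun t ht => ?_
  rcases lt_trichotomy μ 0 with hμ | hμ | hμ
  · exact ⟨0, curl_eq_zero_of_negShell hu hμ hφ hΔ hcl hsl t ht⟩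
  · -- the harmonic shell: bounded harmonic vorticity modes are constant, and so is their span
    subst hμ
    have hWc : ∀ w ∈ Submodule.span ℝ (Set.range fun i => curl (φ i)), ∀ x y, w x = w y := by
      intro w hw
      induction hw using Submodule.span_induction with
      | mem w hw =>
        obtain ⟨i, rfl⟩ := hw
        obtain ⟨A, hA⟩ := hbd i
        exact apply_eq_apply_of_harmonic_bounded (hcφ i) (fun x => by rw [hΔ i x, zero_smul]) hA
      | zero => intro x y; rfl
      | add v w _ _ hv hw => intro x y; simp only [Pi.add_apply, hv x y, hw x y]
      | smul a v _ hv => intro x y; simp only [Pi.smul_apply, hv x y]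
    exact ⟨curl (u t) 0, fun x => hWc _ (hV _ (hmemV t ht)).2 x 0⟩
  · -- a positive shell carries no bounded mode
    have h0 : ∀ i, curl (φ i) = 0 := fun i => by
      obtain ⟨A, hA⟩ := hbd i
      funext x
      exact eq_zero_of_laplacian_eq_smul_of_pos (hcφ i) hμ (hΔ i) hA x
    have hbot : Submodule.span ℝ (Set.range fun i => curl (φ i)) = ⊥ := by
      rw [Submodule.span_eq_bot]
      rintro _ ⟨i, rfl⟩
      exact h0 i
    have hmem := (hV _ (hmemV t ht)).2
    rw [hbot, Submodule.mem_bot] at hmem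
    exact ⟨0, fun x => by rw [hmem]; rfl⟩

end Summit.NavierStokesRegularity.NavierStokesRegularity.Theorems.ScenarioCensus.ModeRank

end
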